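import Literature.Computability.Cryptography.SIS
import Literature.Algebra.EuclideanLattices.GapSVPVerifier
import Literature.Computability.Complexity.AOWListMatrixFP
import Literature.Computability.Complexity.CodeFPBudgets
import HarnessLib

/-!
# The `SIS′` test and the query code on list data, in polynomial time (typed `FP`)

Topic `Computability/Cryptography` (family `pqc`). The run `W(B*, s)` of Micciancio–Regev's Thm. 5.23 (authors'
version p. 29) sends a matrix `A ∈ ℤ_q^{n×m}` to the `SIS′` oracle and keeps its answer `z` only if it IS an `SIS′`
solution (`SIS.IsSolution'`: an odd coordinate, `A z ≡ 0 (mod q)`, `‖z‖ ≤ β`), else aborts. A machine holds `A` as a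
list matrix of representatives and `z` as a list of integers; this file writes the two string-level operations it
needs on these data and proves them typed polynomial time with their values on `ofFn` data:

* `sisCheckL q m num den X z` — the `SIS′` test with `β = num/den` (parity by `2·(x/2) ≠ x`, congruences by
  `S − q·(S/q) = 0`, the norm by `(∑ zⱼ²)·den² ≤ num²`, `num ≥ 0`); **`sisCheckL_ofFn_iff`**: on
  `X = [(A i j).val]`, `z = ofFn z` it holds iff `IsSolution' A β z` for `β = ((num/den : ℚ) : ℝ)` in lowest terms;
  **`sisCheckL_codeFP`**;
* `matQ n m q X` — the code `SIS.encodeMatrix A` written from `(n, m, q, [(A i j).val])` (`encodeMatrix_eq_matQ`);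
  **`matQ_codeFP`**.

All proved; definitions with bodies; no named fact.

## References

* D. Micciancio, O. Regev, *Worst-case to average-case reductions based on Gaussian measures*, SIAM J. Comput.
  37 (2007) 267–302, Def. 5.4 (`SIS′`) and Thm. 5.23 (proof, p. 29: "if z is not a valid solution, abort").
* S. Arora, B. Barak, *Computational Complexity: A Modern Approach*, CUP 2009, §0.1, §1.3 [AroraBarak2009].
-/

namespace Literature.Computability.Cryptography

namespace SISCheck

open _root_.Computability Literature.Computability.Complexity Literature.Computability.Complexity.CodeFP
  Literature.Computability.Complexity.LMat Literature.Algebra.EuclideanLattices SIS Finset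

/-! ### The test on list data -/

/-- The row sum `∑_{j<m} Xᵢⱼ zⱼ`. [folklore] -/
def rowSum (m : ℕ) (z row : List ℤ) : ℤ := sumRange m fun j => row.getD j 0 * z.getD j 0

/-- The row congruence `∑_{j<m} Xᵢⱼ zⱼ ≡ 0 (mod q)`, as `S − q (S / q) = 0`. [folklore] -/
def rowOK (q m : ℕ) (z row : List ℤ) : Bool :=
  decide (rowSum m z row - (q : ℤ) * (rowSum m z row / (q : ℤ)) = 0)

/-- **The `SIS′` test on list data** with `β = num/den`: some `zⱼ` odd, every row congruence, and
`(∑ zⱼ²) den² ≤ num²` with `num ≥ 0`. [cite: MicciancioRegev2007, Def. 5.4] -/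
def sisCheckL (q m : ℕ) (num : ℤ) (den : ℕ) (X : List (List ℤ)) (z : List ℤ) : Bool :=
  ((List.range m).any fun j => !decide (2 * (z.getD j 0 / 2) = z.getD j 0)) &&
    (X.all (rowOK q m z) &&
      (decide (0 ≤ num) && decide (rowSum m z z * ((den : ℤ) * den) ≤ num * num)))

/-! ### Values on `ofFn` data -/

/-- Reading an `ofFn` list. [folklore] -/
theorem getD_ofFn {m : ℕ} (z : Fin m → ℤ) (j : Fin m) : (List.ofFn z).getD (j : ℕ) 0 = z j := by
  rw [List.getD_eq_getElem?_getD, List.getElem?_ofFn]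
  simp

/-- `2 (x / 2) ≠ x ↔ x` odd. [folklore] -/
theorem two_mul_ediv_ne_iff_odd (x : ℤ) : 2 * (x / 2) ≠ x ↔ Odd x := by
  rw [Int.odd_iff, ne_eq]
  omega

/-- `S − q (S/q) = 0 ↔ (S : ZMod q) = 0`. [folklore] -/
theorem sub_mul_ediv_eq_zero_iff (q : ℕ) (S : ℤ) : S - (q : ℤ) * (S / (q : ℤ)) = 0 ↔ ((S : ℤ) : ZMod q) = 0 := by
  rw [ZMod.intCast_zmod_eq_zero_iff_dvd, Int.dvd_iff_emod_eq_zero, Int.emod_def]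

variable {n m q : ℕ}

/-- The row sums on `ofFn` data are the integer lifts of `(A z)ᵢ`. [folklore] -/
theorem rowSum_ofFn (A : Matrix (Fin n) (Fin m) (ZMod q)) (z : Fin m → ℤ) (i : Fin n) :
    rowSum m (List.ofFn z) (List.ofFn fun j => ((A i j).val : ℤ)) = ∑ j, ((A i j).val : ℤ) * z j := by
  rw [rowSum, sumRange_eq_sum]
  refine Finset.sum_congr rfl fun j _ => ?_
  rw [getD_ofFn, getD_ofFn]

/-- `(A z)ᵢ` in `ℤ_q` is the cast of the integer row sum. [folklore] -/
theorem mulVec_modVec_apply [NeZero q] (A : Matrix (Fin n) (Fin m) (ZMod q)) (z : Fin m → ℤ) (i : Fin n) :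
    A.mulVec (modVec q z) i = ((∑ j, ((A i j).val : ℤ) * z j : ℤ) : ZMod q) := by
  rw [Matrix.mulVec, dotProduct]
  push_cast
  refine Finset.sum_congr rfl fun j _ => ?_
  rw [ZMod.natCast_zmod_val]
  rfl

/-- **The list test is `IsSolution'`** on `ofFn` data, for `β = num/den` in lowest terms (`d : ℚ`).
[cite: MicciancioRegev2007, Def. 5.4] -/
theorem sisCheckL_ofFn_iff [NeZero q] (A : Matrix (Fin n) (Fin m) (ZMod q)) (z : Fin m → ℤ) (d : ℚ) :
    sisCheckL q m d.num d.den (List.ofFn fun i => List.ofFn fun j => ((A i j).val : ℤ)) (List.ofFn z) = true ↔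
      IsSolution' A (d : ℝ) z := by
  rw [sisCheckL, IsSolution', Bool.and_eq_true, Bool.and_eq_true, Bool.and_eq_true]
  -- parity
  have h1 : ((List.range m).any fun j => !decide (2 * ((List.ofFn z).getD j 0 / 2) = (List.ofFn z).getD j 0)) = true ↔
      ∃ j, Odd (z j) := by
    rw [List.any_eq_true]
    constructor
    · rintro ⟨j, hj, h⟩
      rw [List.mem_range] at hj
      refine ⟨⟨j, hj⟩, ?_⟩
      rw [← two_mul_ediv_ne_iff_odd, ← getD_ofFn z ⟨j, hj⟩]
      simpa using h
    · rintro ⟨j, hj⟩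
      refine ⟨j, List.mem_range.2 j.isLt, ?_⟩
      rw [← two_mul_ediv_ne_iff_odd, ← getD_ofFn z j] at hj
      simpa using hj
  -- congruences
  have h2 : ((List.ofFn fun i => List.ofFn fun j => ((A i j).val : ℤ)).all (rowOK q m (List.ofFn z))) = true ↔
      A.mulVec (modVec q z) = 0 := by
    rw [List.all_eq_true]
    constructor
    · intro h
      funext i
      have hi := h _ (List.mem_ofFn.2 ⟨i, rfl⟩)
      rw [rowOK, decide_eq_true_eq, sub_mul_ediv_eq_zero_iff, rowSum_ofFn] at hi
      rw [Pi.zero_apply, mulVec_modVec_apply, hi]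
    · intro h row hrow
      obtain ⟨i, rfl⟩ := List.mem_ofFn.1 hrow
      rw [rowOK, decide_eq_true_eq, sub_mul_ediv_eq_zero_iff, rowSum_ofFn, ← mulVec_modVec_apply, h, Pi.zero_apply]
  -- norm
  have h3 : (decide (0 ≤ d.num) = true ∧ decide (rowSum m (List.ofFn z) (List.ofFn z) *
      ((d.den : ℤ) * d.den) ≤ d.num * d.num) = true) ↔ ‖intVecToEuclidean m z‖ ≤ (d : ℝ) := by
    rw [decide_eq_true_eq, decide_eq_true_eq, rowSum, sumRange_eq_sum]
    have hs : ∑ j : Fin m, (List.ofFn z).getD j 0 * (List.ofFn z).getD j 0 = ∑ j, z j ^ 2 :=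
      Finset.sum_congr rfl fun j _ => by rw [getD_ofFn, sq]
    rw [hs]
    have hden : (0 : ℝ) < d.den := by exact_mod_cast d.den_pos
    have hd : (d : ℝ) = d.num / d.den := by rw [← Rat.cast_def]
    constructor
    · rintro ⟨hnum, hle⟩
      have hd0 : 0 ≤ (d : ℝ) := by rw [hd]; exact div_nonneg (by exact_mod_cast hnum) hden.le
      rw [← abs_of_nonneg (norm_nonneg _), ← abs_of_nonneg hd0, ← sq_le_sq, norm_sq_intVecToEuclidean, hd, div_pow,
        le_div_iff₀ (by positivity)]
      rw [← sq, ← sq] at hle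
      exact_mod_cast hle
    · intro h
      have hd0 : 0 ≤ (d : ℝ) := (norm_nonneg _).trans h
      have hnum : 0 ≤ d.num := by
        have : (0 : ℚ) ≤ d := by exact_mod_cast hd0
        exact Rat.num_nonneg.2 this
      refine ⟨hnum, ?_⟩
      have h' := h
      rw [← abs_of_nonneg (norm_nonneg _), ← abs_of_nonneg hd0, ← sq_le_sq, norm_sq_intVecToEuclidean, hd, div_pow,
        le_div_iff₀ (by positivity)] at h'
      rw [← sq, ← sq]
      exact_mod_cast h'
  rw [h1, h2]
  constructor
  · rintro ⟨ho, hA, hn⟩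
    exact ⟨ho, hA, h3.1 (by simpa [Bool.and_eq_true] using hn)⟩
  · rintro ⟨ho, hA, hn⟩
    exact ⟨ho, hA, by simpa [Bool.and_eq_true] using h3.2 hn⟩

/-! ### Polynomial time -/

/-- The code of the test's arguments: `⟨⟨bin q, ⟨1^m, ⟨num, den⟩⟩⟩, ⟨X, z⟩⟩`. [folklore] -/
abbrev chkE : (ℕ × (ℕ × (ℤ × ℕ))) × (List (List ℤ) × List ℤ) → List Bool :=
  pairE (pairE natE (pairE unE (pairE intE natE))) (pairE matE (rawE intE))

/-- `(z, (row, j)) ↦ rowⱼ zⱼ` on codes. [folklore] -/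
theorem prodEntry_codeFP : CodeFP (pairE (pairE (rawE intE) (rawE intE)) natE) intE
    (fun t => t.1.2.getD t.2 0 * t.1.1.getD t.2 0) :=
  (intMul.comp (((rawGetOr intE).comp ((fst _ _).snd'.pair ((snd _ _).pair (const _ (0 : ℤ))))).pair
    ((rawGetOr intE).comp ((fst _ _).fst'.pair ((snd _ _).pair (const _ (0 : ℤ)))))) :)

/-- The row sum on codes: `((z, row), 1^m) ↦ rowSum m z row`. [folklore] -/
theorem rowSum_codeFP : CodeFP (pairE (pairE (rawE intE) (rawE intE)) unE) intE (fun t => rowSum t.2 t.1.1 t.1.2) :=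
  (sumRangeFP prodEntry_codeFP).congr fun _ => rfl

/-- `S ↦ S − q (S / q)` on codes. [folklore] -/
theorem resid_codeFP : CodeFP (pairE intE natE) intE (fun p => p.1 - (p.2 : ℤ) * (p.1 / (p.2 : ℤ))) :=
  (intSub.comp ((fst _ _).pair (intMul.comp ((intOfNat.comp (snd _ _)).pair (intEDiv.comp ((fst _ _).pair (intOfNat.comp (snd _ _))))))) :)

/-- The parity test on codes. [folklore] -/
theorem parity_codeFP : CodeFP (pairE (rawE intE) natE) bitE (fun t => !decide (2 * (t.1.getD t.2 0 / 2) = t.1.getD t.2 0)) := by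
  have hzj : CodeFP (pairE (rawE intE) natE) intE (fun t => t.1.getD t.2 0) :=
    ((rawGetOr intE).comp ((fst _ _).pair ((snd _ _).pair (const _ (0 : ℤ)))) :)
  have h2 : CodeFP (pairE (rawE intE) natE) intE (fun t => 2 * (t.1.getD t.2 0 / 2)) :=
    (intMul.comp ((const _ (2 : ℤ)).pair (intEDiv.comp (hzj.pair (const _ (2 : ℤ))))) :)
  exact ((intEq.comp (h2.pair hzj)).not :)

/-- The row test on codes: `(((z, (1^m, bin q)), row) ↦ rowOK q m z row`. [folklore] -/
theorem rowOK_codeFP : CodeFP (pairE (pairE (rawE intE) (pairE unE natE)) (rawE intE)) bitE (fun t => rowOK t.1.2.2 t.1.2.1 t.1.1 t.2) := by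
  have hS : CodeFP (pairE (pairE (rawE intE) (pairE unE natE)) (rawE intE)) intE (fun t => rowSum t.1.2.1 t.1.1 t.2) :=
    (rowSum_codeFP.comp (((fst _ _).fst'.pair (snd _ _)).pair (fst _ _).snd'.fst') :)
  have hr : CodeFP (pairE (pairE (rawE intE) (pairE unE natE)) (rawE intE)) intE
      (fun t => rowSum t.1.2.1 t.1.1 t.2 - (t.1.2.2 : ℤ) * (rowSum t.1.2.1 t.1.1 t.2 / (t.1.2.2 : ℤ))) :=
    (resid_codeFP.comp (hS.pair (fst _ _).snd'.snd') :)
  exact (intEq.comp (hr.pair (const _ (0 : ℤ))) :)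

/-- **The `SIS′` test is typed polynomial time.** [cite: AroraBarak2009, §1.3] -/
theorem sisCheckL_codeFP : CodeFP chkE bitE (fun p => sisCheckL p.1.1 p.1.2.1 p.1.2.2.1 p.1.2.2.2 p.2.1 p.2.2) := by
  have hq : CodeFP chkE natE (fun p => p.1.1) := (fst _ _).fst'
  have hm : CodeFP chkE unE (fun p => p.1.2.1) := (fst _ _).snd'.fst'
  have hnum : CodeFP chkE intE (fun p => p.1.2.2.1) := (fst _ _).snd'.snd'.fst'
  have hden : CodeFP chkE natE (fun p => p.1.2.2.2) := (fst _ _).snd'.snd'.snd'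
  have hX : CodeFP chkE matE (fun p => p.2.1) := (snd _ _).fst'
  have hz : CodeFP chkE (rawE intE) (fun p => p.2.2) := (snd _ _).snd'
  have hpar : CodeFP chkE bitE (fun p => (List.range p.1.2.1).any fun j => !decide (2 * (p.2.2.getD j 0 / 2) = p.2.2.getD j 0)) :=
    ((any parity_codeFP).comp (hz.pair (urange.comp hm)) :)
  have hall : CodeFP chkE bitE (fun p => p.2.1.all fun row => rowOK p.1.1 p.1.2.1 p.2.2 row) :=
    ((all rowOK_codeFP).comp ((hz.pair (hm.pair hq)).pair hX) :)
  have hsq : CodeFP chkE intE (fun p => rowSum p.1.2.1 p.2.2 p.2.2) := (rowSum_codeFP.comp ((hz.pair hz).pair hm) :)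
  have hd2 : CodeFP chkE intE (fun p => (p.1.2.2.2 : ℤ) * p.1.2.2.2) := (intMul.comp ((intOfNat.comp hden).pair (intOfNat.comp hden)) :)
  have hnorm : CodeFP chkE bitE (fun p => decide (rowSum p.1.2.1 p.2.2 p.2.2 * ((p.1.2.2.2 : ℤ) * p.1.2.2.2) ≤ p.1.2.2.1 * p.1.2.2.1)) :=
    (intLe.comp ((intMul.comp (hsq.pair hd2)).pair (intMul.comp (hnum.pair hnum))) :)
  have hnn : CodeFP chkE bitE (fun p => decide ((0 : ℤ) ≤ p.1.2.2.1)) := (intLe.comp ((const _ (0 : ℤ)).pair hnum) :)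
  exact ((hpar.and (hall.and (hnn.and hnorm))) :)

/-! ### The query code -/

/-- **The code `encodeMatrix A` written from list data** `(n, m, q, rows of representatives)`.
[cite: MicciancioRegev2007, Def. 5.3 (instances (q, A, β))] -/
def matQ (n m q : ℕ) (X : List (List ℤ)) : List Bool :=
  pairE natE (pairE natE (pairE natE (listE (listE natE)))) (n, (m, (q, X.map fun row => row.map Int.toNat)))

/-- `encodeMatrix A = matQ n m q [(A i j).val]`. [cite: MicciancioRegev2007, Def. 5.3] -/
theorem encodeMatrix_eq_matQ (A : Matrix (Fin n) (Fin m) (ZMod q)) :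
    encodeMatrix A = matQ n m q (List.ofFn fun i => List.ofFn fun j => ((A i j).val : ℤ)) := by
  rw [encodeMatrix, matQ]
  simp only [pairE_apply]
  congr 3
  change (encodingFinVec encodingNatBool m).listBool.encode (List.ofFn fun i j => (A i j).val) = _
  rw [listE_eq]
  have hin : ((encodingFinVec encodingNatBool m).encode : (Fin m → ℕ) → List Bool) = fun v => listE natE (List.ofFn v) := by
    funext v
    change encodingNatBool.listBool.encode (List.ofFn v) = _
    rw [listE_eq]; rfl
  rw [hin, List.map_ofFn, List.ofFn_eq_map, List.ofFn_eq_map, listE, listE, rawE, rawE, List.map_map, List.map_map]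
  simp only [List.length_map]
  congr 2
  refine List.map_congr_left fun i _ => ?_
  simp only [Function.comp_apply, List.map_ofFn]
  congr 2

/-- **Writing the query code is typed polynomial time.** [cite: AroraBarak2009, §1.3] -/
theorem matQ_codeFP : CodeFP (pairE natE (pairE natE (pairE natE matE))) strE (fun p => matQ p.1 p.2.1 p.2.2.1 p.2.2.2) := by
  have hn : CodeFP (pairE natE (pairE natE (pairE natE matE))) natE (fun p => p.1) := fst _ _
  have hm : CodeFP (pairE natE (pairE natE (pairE natE matE))) natE (fun p => p.2.1) := (snd _ _).fst'
  have hq : CodeFP (pairE natE (pairE natE (pairE natE matE))) natE (fun p => p.2.2.1) := (snd _ _).snd'.fst'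
  have hX : CodeFP (pairE natE (pairE natE (pairE natE matE))) matE (fun p => p.2.2.2) := (snd _ _).snd'.snd'
  have hrows : CodeFP (pairE natE (pairE natE (pairE natE matE))) (listE (listE natE))
      (fun p => p.2.2.2.map fun row => row.map Int.toNat) := by
    have h1 : CodeFP matE (rawE (listE natE)) (fun X => X.map fun row => row.map Int.toNat) :=
      (map₀ ((listOfRaw natE).comp (map₀ intToNat))).congr fun X => by simp
    exact ((listOfRaw (listE natE)).comp (h1.comp hX)).congr fun _ => rfl
  exact ((hn.pair (hm.pair (hq.pair hrows))) :).recodeOut fun p => rfl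

end SISCheck

end Literature.Computability.Cryptography
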